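import Summits.QuantumFields.YangMills.Theses.RecentredCoverTransfer
import Summits.QuantumFields.YangMills.Theorems.RecentredCoverTransferCellTranslation
import HarnessLib

/-!
# Route `RecentredCoverTransfer` (LINE g9-A of planner ym-idea-1 g9), support item `TwoPointRecentringIdentity` (stmt-QuantumFields-23123)

The `n = 2` recentring identity `dist_C(A; m_C) F − dist_C(A; m) F = −(m_C − m)²·Σ_{(x,y) ∈ reps²} F(A x, A y)` for a continuous
representation, any period cell `C`, coupling `β`, site embedding `A`, bounded measurable observable `O`, centring `m` and Schwartz `F`
— the theorem `dist_two_sub_dist_two` of the kit `Theorems/RecentredCoverTransferCellTranslation` (expand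
`(d_x − m)(d_y − m) = (d_x − m_C)(d_y − m_C) + δ(d_x − m_C) + δ(d_y − m_C) + δ²`, `δ = m_C − m`, and kill the cross terms by
`E_C d_x = m_C`, i.e. `CellMeanShiftInvariant`).

Width seat ym-line-sfw-p2-w3 g28 (cell ym-idea-1; free hands).  THEOREMS ONLY.  No crux, no rung (R2d ROT is a RECORD rung), no summit
and no mass gap is proved by this.
-/

set_option autoImplicit false

namespace Summit.QuantumFields.YangMills.Theorems.RecentredCoverTransfer

/-- **Item stmt-QuantumFields-23123 `RecentredCoverTransfer.TwoPointRecentringIdentity` holds**: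
`dist_C(A; m_C) F − dist_C(A; m) F = −(m_C − m)²·Σ_{x ∈ reps²} F(A x)`. [folklore] -/
theorem twoPointRecentringIdentity_proof :
    Summit.QuantumFields.YangMills.Theses.RecentredCoverTransfer.TwoPointRecentringIdentity := by
  intro G _ _ _ _ _ _ N ρ hρ C β A O hO hB m F
  obtain ⟨B, hB⟩ := hB
  rw [dist_two_sub_dist_two C ρ hρ β A hO hB m F, neg_mul]

end Summit.QuantumFields.YangMills.Theorems.RecentredCoverTransfer
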